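import Summits.Ventures.PercRepro2.CaseOneStarCertT1
import Summits.Ventures.PercRepro2.CaseOneGadgetUWA1BBlockI0
import Summits.Ventures.PercRepro2.CaseOneGadgetUWA1BBlockI1
import Summits.Ventures.PercRepro2.CaseOneGadgetUWA1BBlockI2
import Summits.Ventures.PercRepro2.CaseOneGadgetUWA1BBlockI3
import Summits.Ventures.PercRepro2.CaseOneGadgetUWA1BBlockI4
import Summits.Ventures.PercRepro2.CaseOneGadgetUWA1BBlockI5
import Summits.Ventures.PercRepro2.CaseOneGadgetUWA1BBlockI6
import Summits.Ventures.PercRepro2.CaseOneGadgetUWA1BBlockI7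
import Summits.Ventures.PercRepro2.CaseOneGadgetUWA1BBlockI8
import Summits.Ventures.PercRepro2.CaseOneGadgetUWA1BBlockI9
import Summits.Ventures.PercRepro2.CaseOneGadgetUWA1BBlockI10
import Summits.Ventures.PercRepro2.CaseOneGadgetUWA1BBlockI11
import Summits.Ventures.PercRepro2.CaseOneGadgetUWA1BBlockI12
import Summits.Ventures.PercRepro2.CaseOneGadgetUWA1BBlockI13
import Summits.Ventures.PercRepro2.CaseOneGadgetUWA1BBlockI14
import Summits.Ventures.PercRepro2.CaseOneStarFactsB

/-!
# The gadget `u ~ {w, a₁, b}`, `w ~ {u, a₂, o}` (uwa1b): the cell certificates of `iAB5` (part 42e)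
(blind cell PercRepro2, p1 g34; the fourth gadget anchor of the six-form calculus — all six forms of the uwa1b gadget
as plain SFacts-cone certificate chains, generated by mining/p1/g34/uwa1b/genu.py = p1 g33's gent_uwa1.py / g25's
geno.py re-targeted; P1-G33 §6–§6″, P1-G34)

Each `eBABI ijk kl` is a nonnegative combination of `(pairwise atom) × (cell)` and cubic cell monomials — or, for the degree-4 ones, `M × eBABI ijk kl` (`M = Σ cᵢ` the total cell mass) is a nonnegative combination of `(atom) × (cell) × (cell)` and quartic cell monomials, then `SFacts.nonneg_of_sum_mul` (`CaseOneStarCertT1`) — exact LP certificates (kit j319447, every certificate re-verified exactly; data/p1/g33/gcerts_i_uwa1b.json, form `i`), here as exact `linear_combination`s over `SFacts` (the rational coefficients cleared by their common denominator). -/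

namespace Summit.Ventures.PercRepro2

namespace CaseOne

section CertABI42e
variable {R : Type*} [Field R] [LinearOrder R] [IsStrictOrderedRing R]

set_option maxHeartbeats 0 in
/-- `eBABI33301 ≥ 0`: the combination is identically zero (`ring`). -/
lemma eBABI33301_nonneg (m : SCells R) (_hf : SFactsB m) : 0 ≤ eBABI33301 m := by
  have h : eBABI33301 m = 0 := by
    unfold eBABI33301 cBABI00101 cBABI00201 cBABI01001 cBABI01101 cBABI01201 cBABI01301 cBABI02001 cBABI02101 cBABI02201 cBABI02301 cBABI03101 cBABI03201 cBABI03301 cBABI10001 cBABI10101 cBABI10201 cBABI10301 cBABI11001 cBABI11101 cBABI11201 cBABI11301 cBABI12001 cBABI12101 cBABI12201 cBABI12301 cBABI13001 cBABI13101 cBABI13201 cBABI13301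
    ring
  linarith [h]

set_option maxHeartbeats 0 in
/-- `eBABI33302 ≥ 0`: the combination is identically zero (`ring`). -/
lemma eBABI33302_nonneg (m : SCells R) (_hf : SFactsB m) : 0 ≤ eBABI33302 m := by
  have h : eBABI33302 m = 0 := by
    unfold eBABI33302 cBABI00102 cBABI00202 cBABI01002 cBABI01102 cBABI01202 cBABI01302 cBABI02002 cBABI02102 cBABI02202 cBABI02302 cBABI03102 cBABI03202 cBABI03302 cBABI10002 cBABI10102 cBABI10202 cBABI10302 cBABI11002 cBABI11102 cBABI11202 cBABI11302 cBABI12002 cBABI12102 cBABI12202 cBABI12302 cBABI13002 cBABI13102 cBABI13202 cBABI13302 cBABI20002 cBABI20102 cBABI20202 cBABI20302 cBABI21002 cBABI21102 cBABI21202 cBABI21302 cBABI22002 cBABI22102 cBABI22202 cBABI22302 cBABI23002 cBABI23102 cBABI23202 cBABI23302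
    ring
  linarith [h]

end CertABI42e

end CaseOne

end Summit.Ventures.PercRepro2
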